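import Literature.MathematicalPhysics.QuantumFieldTheory.ConformalBootstrap3D.PointKernelK34v2Data
import Literature.MathematicalPhysics.QuantumFieldTheory.ConformalBootstrap3D.PointKernelParts

/-!
# K34v2 certificate, kernel part file P46: one-cell head segments 153, 154 in level ranges

The head cells whose kernel evaluation exceeds one `decide` are one-cell segments of `hsegsK34v2`; each is
checked by `PCert.hPartSideOK` (side conditions) and `PCert.hPartOK` per level range `[n_lo, n_lo + count)`
against an integer claim, the claims summing to `≥ 0` (`PointKernel.partsOK`); soundness is
`PCert.hParts_sound` (`PointKernelParts`).  The part files `P1, P2, …` are mutually independent (each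
imports only the data file); the ranges of one cell may span several of them, and the per-cell
conclusions `hparts_i` / `hcell_i` of those cells are assembled in `PointKernelK34v2.lean`.
Estimated kernel time 233 s.
-/

set_option maxRecDepth 100000
set_option maxHeartbeats 0

namespace Literature.MathematicalPhysics.QuantumFieldTheory.ConformalBootstrap3D.PointKernelK34v2

open Literature.MathematicalPhysics.QuantumFieldTheory.ConformalBootstrap3D.PointKernel

/-- levels `[60, 64)` of segment 153: partial lower sum `≥` claim. [folklore] -/
theorem part_153_6 : certK34v2.hPartOK (PCert.segAt hsegsK34v2 153) JHK34v2 60 4 (377410682691391978221230469988888950) = true := by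
  decide +kernel

/-- levels `[64, 68)` of segment 153: partial lower sum `≥` claim. [folklore] -/
theorem part_153_7 : certK34v2.hPartOK (PCert.segAt hsegsK34v2 153) JHK34v2 64 4 (228093819653031527480495117587326196) = true := by
  decide +kernel

/-- levels `[68, 71)` of segment 153: partial lower sum `≥` claim. [folklore] -/
theorem part_153_8 : certK34v2.hPartOK (PCert.segAt hsegsK34v2 153) JHK34v2 68 3 (97631203948793886676163926074838793) = true := by
  decide +kernel

/-- levels `[71, 73)` of segment 153: partial lower sum `≥` claim. [folklore] -/
theorem part_153_9 : certK34v2.hPartOK (PCert.segAt hsegsK34v2 153) JHK34v2 71 2 (31635829298269567863686427519780645) = true := by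
  decide +kernel

/-- one-cell segment 154 (row 6, cell `[7175/1024, 897/128]`, chord, `n_F = 64`,
6 level ranges): side conditions. [folklore] -/
theorem pside_154 : certK34v2.hPartSideOK (PCert.segAt hsegsK34v2 154) JHK34v2 = true := by
  decide +kernel

/-- its level ranges `(n_lo, count, claim)`. [folklore] -/
def parts_154 : List (ℕ × ℕ × ℤ) := [(0, 28, -33068936852440987258717936395288922194), (28, 12, 23469255416331157253952876030964629508), (40, 9, 6472295679776823402263313147002227793), (49, 7, 2073042056156847554378363481949980609), (56, 5, 726152202676371408866402980920331435), (61, 4, 328191497499787639256980754451752851)]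

/-- the ranges tile `[0, n_F]` and the claims sum to `≥ 0`. [folklore] -/
theorem pcov_154 : PointKernel.partsOK 64 parts_154 = true := by
  decide +kernel

end Literature.MathematicalPhysics.QuantumFieldTheory.ConformalBootstrap3D.PointKernelK34v2
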